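import Literature.MathematicalPhysics.QuantumFieldTheory.Balaban1983to89.B10Eq5RegularAction
import Literature.MathematicalPhysics.QuantumFieldTheory.Balaban1983to89.T4StabilityFloor
import Summits.QuantumFields.Balaban3D.Proofs.Terminal3
import Summits.QuantumFields.Balaban3D.Proofs.EndTheorem

/-!
# Bałaban CMP 102 (1985), d = 3 lane — `Proofs.Reg44Terminal`: the regularity input of **(3) ⇐ (5)** DISCHARGED from the printed
# display **(44)** (spine `SectB.TowerObjects.Reg44AsPrinted`, AS PRINTED) and the trace inequality of **(11)**, for tower
# constructions with a group as printed

Source: T. Bałaban, CMP **102** (1985) 255–275 [Balaban1985UV3]: p. 267 = PDF 13 L2–3 (the sentence before (44)) «The configuration U_k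
satisfies the following regularity condition on Ω_k: |U_k(∂p) − 1| < 2L²B₃g_{k−1}p(g_{k−1})η².»; (11) p. 258 L17–22 «exp[−(1/g₀²)[1 −
Re tr U(∂p)]] = exp[−(1/2g₀²)|U(∂p) − 1|²]»; (5) p. 256 L37 «A^η(U_k(U)) = Σ_{p⊂T_η} η^{−1}[1 − Re tr U_k(U)(∂p)], η = L^{−k}».  Lane
`pub-balaban3d`, seat p3 (PLAN §3.1 «(3) for run3»; closes the NOT-IN-PRINT hypothesis `Terminal3.Reg44ActionBound` reported in STATUS).

WHAT THIS FILE PROVES (kernel-checked; standard axioms):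
* `groupModel_one_sub_reTr_le_of_lt` — for a group as printed (`Setting.GroupModel`: `G ⊂ U(N)`, `dist1 = ‖· − 1‖_op`, `reTr = Re Tr/N`):
  `|g − 1| < δ ⇒ 1 − Re tr g ≤ ½δ²` (the 4D cell's `B10Eq5RegularAction.one_sub_nReTr_le_half_opDist1_sq`, (11) upper direction; print's
  equality holds for the normalised Hilbert–Schmidt norm, cell DIVERGENCE D-b10.1; the unthresholded form `1 − Re tr g ≤ ½|g − 1|²` is
  seat p4's `Reg44Action.one_sub_reTr_le`, not restated here — R-DEDUP).
* `card_plaq_three` — the fine torus `T_η` of a d = 3 approximation has `3·#sites` positively oriented plaquettes (`T4StabilityFloor.card_plaq`;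
  real-cast form; seat p4's `Reg44Action.card_plaq_d3` is the `ℕ` form).
* `actionEta_le_of_plaqSmall`, `actionEta_K_le_of_reg` — `A^η(U) ≤ η⁻¹·½δ²·#plaquettes` when every `|U(∂p) − 1| < δ`; at `k = K` with
  `δ = c·η²`: `A^η(U) ≤ (3/2)c²·|T₁^{(K)}|` (`η³·#T_η = |T₁^{(K)}|`, `ScalesArithmetic`).
* **`reg44ActionBound_of_reg44AsPrinted`** — for a tower construction `mkT` using the family constants (`EndTheorem.UsesConsts`), IF the
  printed (44) holds at the terminal step for the history without large fields whenever `V` is in the small-field domain (4)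
  (`(mkT G 𝔊 S).chi K V ≠ 0 → SectB.TowerObjects.Reg44AsPrinted B₃ K (triv K) V` — an (α) DATA display about the minimizer of [7], lane
  ruling R-DISP: admissible end hypothesis by its spine name), THEN `Terminal3.Reg44ActionBound mkT.toConstruction` with the explicit
  `a = 6L⁴B₃²·b₀²p₀^{2p₀}e^{2−2p₀}` (`B10.gsq_psq_le` on `g_{K−1} ≤ 1`).  Hence `uvStability3_of_reg44AsPrinted`:
  `Thm1AsPrintedCompact mkT.toConstruction → (44)_K as printed → UVStability3AsPrinted mkT.toConstruction` — (3) p. 256 with its clause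
  «O(1) depending on g and ε₀ only» from Theorem 1 and a PRINTED display, no unprinted hypothesis left.
HONEST FRAMING (PLAN §0): (44) is consumed as a hypothesis (it is [7] Thm 1's regularity, binder b11); nothing of it is asserted.
-/

namespace Summit.QuantumFields.Balaban3D.Proofs.Reg44Terminal

open Literature.MathematicalPhysics.QuantumFieldTheory.Balaban1983to89
open Literature.MathematicalPhysics.QuantumFieldTheory.Balaban1985CMP102.Setting
open Literature.MathematicalPhysics.QuantumFieldTheory.Balaban1985CMP102.Theorems
open Literature.MathematicalPhysics.QuantumFieldTheory.Balaban1985CMP102.SectB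
open Summit.QuantumFields.Balaban3D.Proofs.ScalesArithmetic
open Summit.QuantumFields.Balaban3D.Proofs.Constants
open Summit.QuantumFields.Balaban3D.Proofs.Terminal3
open Summit.QuantumFields.Balaban3D.Proofs.EndTheorem

variable {L : ℕ}

/-! ## §1 (11), upper direction, for a group as printed -/

/-- **(11) p. 258, upper direction, for a group AS PRINTED, thresholded** (`GroupModel`: faithful unitary realisation `ρ : G → U(N)`,
`dist1 g = ‖ρ g − 1‖_op`, `reTr g = Re Tr ρ(g)/N`): on a plaquette with `|U(∂p) − 1| < δ`, `1 − Re tr U(∂p) ≤ ½δ²`.  The 4D cell's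
`B10Eq5RegularAction.one_sub_nReTr_le_half_opDist1_sq` (`1 − Re Tr U/N ≤ ½‖U − 1‖²_op` on `U(N)`) transported along
`GroupModel.reTr_eq`/`dist1_eq` (the unthresholded transport is seat p4's `Reg44Action.one_sub_reTr_le`). [cite: Balaban1985UV3, (11) p.258] -/
theorem groupModel_one_sub_reTr_le_of_lt {G : Type} [GaugeGroup G] [MeasurableSpace G] (𝔊 : GroupModel G) {g : G} {δ : ℝ}
    (h : dist1 g < δ) : 1 - reTr g ≤ (1 / 2) * δ ^ 2 := by
  haveI : Nonempty (Fin 𝔊.N) := ⟨⟨0, 𝔊.N_pos⟩⟩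
  have h0 : 0 ≤ dist1 g := by rw [𝔊.dist1_eq]; exact UnitaryModel.opDist1_nonneg _
  have h1 : 1 - reTr g ≤ (1 / 2) * dist1 g ^ 2 := by
    rw [𝔊.reTr_eq, 𝔊.dist1_eq]
    exact B10Eq5RegularAction.one_sub_nReTr_le_half_opDist1_sq (𝔊.mem_unitary g)
  have h2 : dist1 g ^ 2 ≤ δ ^ 2 := pow_le_pow_left₀ h0 h.le 2
  nlinarith

/-! ## §2 Plaquette counting on the d = 3 tori of `Setup` -/

/-- **`#plaquettes(T^{(j)}) = 3·#sites(T^{(j)})`** (real form) for the d = 3 tori of a lattice approximation (`T4StabilityFloor.card_plaq`: a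
positively oriented plaquette is a site with a pair `μ < ν`; there are `3` pairs `μ < ν` in three dimensions — LQB
`MassGapTransferHC.card_lt_pairs_fin_three`, here by `decide`; the `ℕ` form is seat p4's `Reg44Action.card_plaq_d3`). [cite: Balaban1985UV3, (5) p.256] -/
theorem card_plaq_three (S : Scales L) (j : ℕ) :
    (Fintype.card (Plaq S.P j) : ℝ) = 3 * Fintype.card (Site S.P j) := by
  have h := T4StabilityFloor.card_plaq S.P j
  have h3 : Fintype.card {x : Fin S.P.d × Fin S.P.d // x.1 < x.2} = 3 := by
    show Fintype.card {x : Fin 3 × Fin 3 // x.1 < x.2} = 3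
    decide
  rw [h3, ← Site.card_site] at h
  rw [h]
  push_cast
  ring

/-! ## §3 The fine action of a plaquette-regular configuration -/

/-- `A^η(U) = Σ_{p⊂T_η} η⁻¹[1 − Re tr U(∂p)] ≤ η⁻¹·½δ²·#plaquettes(T_η)` whenever every `|U(∂p) − 1| < δ` (group as printed).
[cite: Balaban1985UV3, (5) p.256 + (11) p.258] -/
theorem actionEta_le_of_plaqSmall {G : Type} [GaugeGroup G] [MeasurableSpace G] (𝔊 : GroupModel G) (S : Scales L) (k : ℕ)
    (U : GaugeField S.P 0 G) {δ : ℝ} (hU : PlaqSmall δ U) :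
    S.actionEta k U ≤ (S.eta k)⁻¹ * ((1 / 2) * δ ^ 2) * Fintype.card (Plaq S.P 0) := by
  unfold Scales.actionEta wilsonAction
  have hη : 0 ≤ (S.eta k)⁻¹ := by
    unfold Scales.eta Params.eta
    have := L_pos S
    positivity
  calc ∑ p : Plaq S.P 0, (S.eta k)⁻¹ * (1 - reTr (GaugeField.plaqHol U p))
      ≤ ∑ _p : Plaq S.P 0, (S.eta k)⁻¹ * ((1 / 2) * δ ^ 2) :=
        Finset.sum_le_sum fun p _ => mul_le_mul_of_nonneg_left (groupModel_one_sub_reTr_le_of_lt 𝔊 (hU p)) hη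
    _ = (S.eta k)⁻¹ * ((1 / 2) * δ ^ 2) * Fintype.card (Plaq S.P 0) := by
        rw [Finset.sum_const, Finset.card_univ, nsmul_eq_mul]; ring

/-- `η³·#T_η = |T₁^{(K)}|` at the terminal step (`η = L^{−K}`, `#T_η = (2L^{m+K})³`, `|T₁^{(K)}| = (2L^m)³`). [cite: Balaban1985UV3, (5) p.256] -/
theorem eta_cube_mul_card_site_zero (S : Scales L) :
    S.eta S.K ^ 3 * Fintype.card (Site S.P 0) = S.sites S.K := by
  rw [sites_eq_card S S.K (by omega), card_site_eq S 0, card_site_eq S S.K, Nat.sub_zero, Nat.add_sub_cancel]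
  unfold Scales.eta Params.eta
  have hL : (L : ℝ) ≠ 0 := (L_pos S).ne'
  show (((L : ℝ)⁻¹) ^ S.K) ^ 3 * (2 * (L : ℝ) ^ (S.m + S.K)) ^ 3 = (2 * (L : ℝ) ^ S.m) ^ 3
  rw [inv_pow, pow_add]
  field_simp

/-- **At the terminal step:** if every `|U(∂p) − 1| < c·η²` on `T_η` (`c ≥ 0` arbitrary), then `A^η(U) ≤ (3/2)c²·|T₁^{(K)}|` —
`η⁻¹·½(cη²)²·3η⁻³|T₁^{(K)}|`. [cite: Balaban1985UV3, (5) p.256 + (44) p.267] -/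
theorem actionEta_K_le_of_reg {G : Type} [GaugeGroup G] [MeasurableSpace G] (𝔊 : GroupModel G) (S : Scales L)
    (U : GaugeField S.P 0 G) {c : ℝ} (hU : PlaqSmall (c * S.eta S.K ^ 2) U) :
    S.actionEta S.K U ≤ (3 / 2) * c ^ 2 * S.sites S.K := by
  have h := actionEta_le_of_plaqSmall 𝔊 S S.K U hU
  rw [card_plaq_three S 0, ← eta_cube_mul_card_site_zero S] at *
  have hη0 : 0 < S.eta S.K := by
    unfold Scales.eta Params.eta; have := L_pos S; positivity
  have key : (S.eta S.K)⁻¹ * ((1 / 2) * (c * S.eta S.K ^ 2) ^ 2) * (3 * (Fintype.card (Site S.P 0) : ℝ))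
      = (3 / 2) * c ^ 2 * (S.eta S.K ^ 3 * Fintype.card (Site S.P 0)) := by
    field_simp
  linarith [key]

/-! ## §4 `Terminal3.Reg44ActionBound` from the printed (44) at the terminal step -/

/-- **THE REGULARITY INPUT OF (3) ⇐ (5) FROM THE PRINTED (44).**  For a tower construction using the family's constants (`UsesConsts`:
in particular `b₀, p₀` are the family's), IF for every group as printed, every lattice approximation and every `V` in the small-field
domain (4) at the terminal step the display (44) p. 267 holds for the minimizer of the history without large fields
(`SectB.TowerObjects.Reg44AsPrinted B₃ K (triv K) V`: «|U_k(∂p) − 1| < 2L²B₃g_{k−1}p(g_{k−1})η²» on all of `T_η`), THEN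
`Terminal3.Reg44ActionBound mkT.toConstruction` holds with `a = (3/2)(2L²B₃)²·b₀²p₀^{2p₀}e^{2−2p₀} = 6L⁴B₃²b₀²p₀^{2p₀}e^{2−2p₀}`
(`g_{K−1}²p(g_{K−1})² ≤ b₀²p₀^{2p₀}e^{2−2p₀}` by `B10.gsq_psq_le`, `0 < g_{K−1} ≤ 1` by `Scales.gK_le_one`) — a function of the
family constants only. [cite: Balaban1985UV3, (44) p.267 + (11) p.258 + (3) p.256] -/
theorem reg44ActionBound_of_reg44AsPrinted (mkT : TowerConstruction L) (C : B10Assembly.Consts)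
    (hW : ∀ (G : Type) [GaugeGroup G] [MeasurableSpace G] [HaarData G] (𝔊 : GroupModel G) (S : Scales L),
      UsesConsts C (mkT G 𝔊 S))
    {B₃ : ℝ}
    (h44 : ∀ (G : Type) [GaugeGroup G] [MeasurableSpace G] [HaarData G] (𝔊 : GroupModel G) (S : Scales L)
      (V : GaugeField S.P S.K G), (mkT G 𝔊 S).chi S.K V ≠ 0 →
        (mkT G 𝔊 S).Reg44AsPrinted B₃ S.K ((mkT G 𝔊 S).triv S.K) V) :
    Reg44ActionBound mkT.toConstruction := by
  intro G _ _ _ 𝔊 g ε₀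
  refine ⟨(3 / 2) * (2 * (L : ℝ) ^ 2 * B₃) ^ 2 * (C.b₀ ^ 2 * (C.p₀ ^ (2 * C.p₀) * Real.exp (2 - 2 * C.p₀))),
    by have := C.p₀_pos; positivity, fun S _ _ V hχ => ?_⟩
  set W := mkT G 𝔊 S with hWdef
  -- (44) at the terminal step, trivial history: every plaquette of T_η, minimizer U_K(V)
  have h := h44 G 𝔊 S V hχ
  have hsmall : PlaqSmall (2 * (L : ℝ) ^ 2 * B₃ * (S.gk (S.K - 1) * B10.pFun W.b₀ W.p₀ (S.gk (S.K - 1))) * S.eta S.K ^ 2)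
      (W.Uk S.K V) := by
    intro p
    have hp := h p (by rw [W.plaqsIn_triv]; exact Set.mem_univ p)
    rwa [W.UkH_triv] at hp
  -- the fine action of U_K(V) ≤ (3/2)·c²·|T₁^{(K)}| with c = 2L²B₃·g_{K−1}p(g_{K−1})
  have hA := actionEta_K_le_of_reg 𝔊 S (W.Uk S.K V) hsmall
  -- g_{K−1}² p(g_{K−1})² ≤ b₀² p₀^{2p₀} e^{2−2p₀}
  have hb : W.b₀ = C.b₀ := (hW G 𝔊 S).b₀_eq
  have hp : W.p₀ = C.p₀ := (hW G 𝔊 S).p₀_eq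
  have hg0 : 0 < S.gk (S.K - 1) := gk_pos S _
  have hg1 : S.gk (S.K - 1) ≤ 1 := gk_le_one S S.gK_le_one _ (Nat.sub_le _ _)
  have hgp := B10.gsq_psq_le C.b₀ C.p₀ (S.gk (S.K - 1)) C.p₀_pos hg0 hg1
  rw [hb, hp] at hA
  have hs : 0 ≤ S.sites S.K := sites_nonneg S S.K
  have hsq : (2 * (L : ℝ) ^ 2 * B₃ * (S.gk (S.K - 1) * B10.pFun C.b₀ C.p₀ (S.gk (S.K - 1)))) ^ 2
      = (2 * (L : ℝ) ^ 2 * B₃) ^ 2 * (S.gk (S.K - 1) ^ 2 * B10.pFun C.b₀ C.p₀ (S.gk (S.K - 1)) ^ 2) := by ring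
  rw [hsq] at hA
  have hmono : (3 / 2) * ((2 * (L : ℝ) ^ 2 * B₃) ^ 2 * (S.gk (S.K - 1) ^ 2 * B10.pFun C.b₀ C.p₀ (S.gk (S.K - 1)) ^ 2))
      * S.sites S.K ≤ (3 / 2) * (2 * (L : ℝ) ^ 2 * B₃) ^ 2 * (C.b₀ ^ 2 * (C.p₀ ^ (2 * C.p₀) * Real.exp (2 - 2 * C.p₀)))
      * S.sites S.K := by
    apply mul_le_mul_of_nonneg_right _ hs
    have h2 : 0 ≤ (3 / 2 : ℝ) * (2 * (L : ℝ) ^ 2 * B₃) ^ 2 := by positivity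
    nlinarith [mul_le_mul_of_nonneg_left hgp h2]
  exact hA.trans hmono

/-- **(3) WITH ITS UNIFORMITY CLAUSE FROM THEOREM 1 AND THE PRINTED (44)**: for a tower construction using the family's constants,
`Theorems.Thm1AsPrintedCompact mkT.toConstruction` and (44) at the terminal step (as above) give `Theorems.UVStability3AsPrinted
mkT.toConstruction` — p. 256 L19–24 «χ(U)e^{−O(1)|T_ε|} ≤ ρ_K(U) ≤ e^{O(1)|T_ε|} … with a constant O(1) depending on g and ε₀ only».
[cite: Balaban1985UV3, (3) p.256 + Thm 1 p.257 + (44) p.267] -/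
theorem uvStability3_of_reg44AsPrinted (mkT : TowerConstruction L) (C : B10Assembly.Consts)
    (hW : ∀ (G : Type) [GaugeGroup G] [MeasurableSpace G] [HaarData G] (𝔊 : GroupModel G) (S : Scales L),
      UsesConsts C (mkT G 𝔊 S))
    {B₃ : ℝ}
    (h44 : ∀ (G : Type) [GaugeGroup G] [MeasurableSpace G] [HaarData G] (𝔊 : GroupModel G) (S : Scales L)
      (V : GaugeField S.P S.K G), (mkT G 𝔊 S).chi S.K V ≠ 0 →
        (mkT G 𝔊 S).Reg44AsPrinted B₃ S.K ((mkT G 𝔊 S).triv S.K) V)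
    (h1 : Thm1AsPrintedCompact mkT.toConstruction) : UVStability3AsPrinted mkT.toConstruction :=
  uvStability3_of_thm1AsPrintedCompact mkT.toConstruction (reg44ActionBound_of_reg44AsPrinted mkT C hW h44) h1

end Summit.QuantumFields.Balaban3D.Proofs.Reg44Terminal
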